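import Mathlib
import Literature.Analysis.Convex.LinearProgrammingDuality
import Literature.Computability.Complexity.ApproximateDegreeDuality
import HarnessLib

/-!
# The dual characterization of one-sided approximate degree (Bun–Thaler 2015, Theorem 6), by LP duality

Source (read first-hand 2026-08-28, held text `paper:arxiv-1311.1616`, §3.1.2 = chunk p0012–p0013 of
the arXiv version): M. Bun, J. Thaler, *Hardness amplification and the approximate degree of
constant-depth circuits*, ICALP 2015 (LNCS 9134), full version arXiv:1311.1616 [BunThaler2015];
theorem numbering of the arXiv version.

Printed statements (verbatim up to notation; cube `{−1,1}ⁿ`, `χ_S` the characters):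

* §3.1.2: "We introduce a relaxed notion of the approximate degree of `f` which we call the one-sided
  `ε`-approximate degree, denoted by `odeg_ε(f)`. This is the least degree of a real polynomial `p` …
  that is an `ε`-one-sided approximation to `f`, meaning: `|p(x) − 1| ≤ ε` for all `x ∈ f⁻¹(1)`;
  `p(x) ≤ −1 + ε` for all `x ∈ f⁻¹(−1)`. That is, we require `p` to be very accurate on inputs in
  `f⁻¹(1)`, but only require 'one-sided accuracy' on inputs in `f⁻¹(−1)`."  Then the primal LP
  (`min ε` s.t. `|f(x) − Σ_{|S|≤d} c_Sχ_S(x)| ≤ ε` for `x ∈ f⁻¹(1)`, `Σ_{|S|≤d} c_Sχ_S(x) ≤ −1 + ε` for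
  `x ∈ f⁻¹(−1)`, `ε ≥ 0`) and its dual (`max Σ_x φ(x)f(x)` s.t. `Σ_x|φ(x)| = 1`,
  `Σ_x φ(x)χ_S(x) = 0` for each `|S| ≤ d`, `φ(x) ≤ 0` for each `x ∈ f⁻¹(−1)`).
* **Theorem 6** (§3.1.2): "Let `f : {−1,1}ⁿ → {−1,1}` be a Boolean function. Then `odeg_ε(f) > d` if
  and only if there is a polynomial `φ : {−1,1}ⁿ → ℝ` such that `Σ_x f(x)φ(x) > ε`, `Σ_x |φ(x)| = 1`,
  `Σ_x φ(x)χ_S(x) = 0` for each `|S| ≤ d`, and `φ(x) ≤ 0` for each `x ∈ f⁻¹(−1)`."  (§3.1.2, after the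
  LPs: "a feasible solution `φ` to this dual LP is a feasible solution to the dual LP for approximate
  degree, with the additional constraint that `φ(x)` agrees in sign with `f(x)` whenever
  `x ∈ f⁻¹(−1)`. We refer to any such feasible solution `φ` as a dual polynomial for `f` with
  one-sided error."  Also: "`odeg_ε(f)` is always at most `adeg_ε(f)`" (§1.1).)

Rendering.  As in `ApproximateDegreeDuality.lean` (Bun–Thaler 2013, Theorem 1 = this paper's
Theorem 5), whose vocabulary is reused: the cube is `Fin n → Bool`, `deg p ≤ d` is `HasDegreeLE d p`,
a dual polynomial is `IsDualPolynomial ε d f φ` (`ε < Σ fφ`, `Σ|φ| = 1`, pure high degree `d`).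
Everything is typed for REAL-valued `f` (print: Boolean), reading "`x ∈ f⁻¹(1)`" as "`f x ≠ −1`"
(two-sided accuracy `|p(x) − f(x)| ≤ ε` wherever `f(x) ≠ −1`, one-sided accuracy `p(x) ≤ −1 + ε` where
`f(x) = −1`), which is the printed notion for Boolean `f`: `IsOneSidedApprox ε f p`,
`HasOneSidedApproxDegreeLE ε d f`, `oneSidedApproxDegree ε f` (`odeg_ε`), and a dual polynomial
with one-sided error `IsOneSidedDualPolynomial ε d f φ` (`IsDualPolynomial ∧ φ ≤ 0` on `f⁻¹(−1)`).

What is proved (no named facts): weak duality `IsOneSidedDualPolynomial.not_hasOneSidedApproxDegreeLE`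
(the one-line estimate `Σ fφ = Σ (f − p)φ ≤ ε Σ|φ|`, using `φ ≤ 0` exactly where only `p ≤ f + ε` is
known); strong duality `exists_oneSidedDualPolynomial` from the tree's Duality theorem of linear
programming `Literature.Analysis.Convex.LPDuality.duality` (Schrijver 1986 Cor. 7.1g) applied to the
printed primal in the form `max −t` s.t. `p(x) − t ≤ f(x)` (all `x`), `−p(x) − t ≤ −f(x)` (`f(x) ≠ −1`),
`−t ≤ 0`, unknowns `(c_S)_{|S|≤d}, t`; the dual vector `(y⁺_x, y⁻_x, s) ≥ 0` is read as
`φ = y⁻·𝟙[f ≠ −1] − y⁺`, which is orthogonal to the `χ_S`, has `Σ|φ| ≤ 1`, value `Σ fφ = t* > ε` and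
`φ ≤ 0` on `f⁻¹(−1)`, and is then normalised; **Theorem 6** (`BunThaler2015_thm6`:
`d < oneSidedApproxDegree ε f ↔ ∃ φ, IsOneSidedDualPolynomial ε d f φ`, for `ε ≥ 0`); and
`odeg_ε ≤ adeg_ε` (`HasApproxDegreeLE.hasOneSidedApproxDegreeLE`).

Typed for the pnp-psdrank cell (memo LIT-39 (N2): one-sided approximate degree is the second of the
printed notions next to the cell's (BSM) question).  No new notation, no instances.
-/

noncomputable section

open Finset Matrix
open Literature.Probability.RandomGraphs.LowDegree (walsh)
open Literature.Computability.Complexity.LowDegree (cubeFourierCoeff)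
open Literature.Combinatorics.Optimization (HasDegreeLE hasDegreeLE_iff_cubeFourierCoeff_eq_zero
  cubeFourierCoeff_sum_walsh)
open Literature.Computability.Complexity.ApproximateDegree (HasPureHighDegree IsDualPolynomial
  HasApproxDegreeLE hasDegreeLE_card)

namespace Literature.Computability.Complexity.OneSidedApproximateDegree

variable {n : ℕ}

/-! ### Definitions -/

/-- **`p` is an `ε`-one-sided approximation to `f`**: `|p(x) − f(x)| ≤ ε` wherever `f(x) ≠ −1`
(for Boolean `f`: on `f⁻¹(1)`, where it reads `|p(x) − 1| ≤ ε`) and `p(x) ≤ −1 + ε` wherever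
`f(x) = −1`. [cite: BunThaler2015, §3.1.2 (definition of ε-one-sided approximation)] -/
def IsOneSidedApprox (ε : ℝ) (f p : (Fin n → Bool) → ℝ) : Prop :=
  (∀ x, f x ≠ -1 → |p x - f x| ≤ ε) ∧ (∀ x, f x = -1 → p x ≤ -1 + ε)

/-- **`odeg_ε(f) ≤ d`**: some `p` of degree `≤ d` is an `ε`-one-sided approximation to `f`.
[cite: BunThaler2015, §3.1.2] -/
def HasOneSidedApproxDegreeLE (ε : ℝ) (d : ℕ) (f : (Fin n → Bool) → ℝ) : Prop :=
  ∃ p : (Fin n → Bool) → ℝ, HasDegreeLE d p ∧ IsOneSidedApprox ε f p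

/-- **The one-sided `ε`-approximate degree `odeg_ε(f)`**: the least such `d` (attained for `ε ≥ 0`,
`hasOneSidedApproxDegreeLE_self`). [cite: BunThaler2015, §3.1.2] -/
def oneSidedApproxDegree (ε : ℝ) (f : (Fin n → Bool) → ℝ) : ℕ :=
  sInf {d | HasOneSidedApproxDegreeLE ε d f}

/-- **A dual polynomial for `f` with one-sided error** (a dual witness for `odeg_ε(f) > d`): a dual
polynomial (`Σ fφ > ε`, `Σ|φ| = 1`, pure high degree `d`) with, additionally, `φ(x) ≤ 0` for each
`x ∈ f⁻¹(−1)`. [cite: BunThaler2015, §3.1.2, Thm 6] -/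
def IsOneSidedDualPolynomial (ε : ℝ) (d : ℕ) (f φ : (Fin n → Bool) → ℝ) : Prop :=
  IsDualPolynomial ε d f φ ∧ ∀ x, f x = -1 → φ x ≤ 0

/-! ### Elementary properties -/

/-- An `ε`-approximation is an `ε`-one-sided approximation: `odeg_ε(f) ≤ adeg_ε(f)`
("`odeg_ε(f)` is always at most `adeg_ε(f)`"). [cite: BunThaler2015, §1.1 and §3.1.2] -/
theorem _root_.Literature.Computability.Complexity.ApproximateDegree.HasApproxDegreeLE.hasOneSidedApproxDegreeLE
    {ε : ℝ} {d : ℕ} {f : (Fin n → Bool) → ℝ} (h : HasApproxDegreeLE ε d f) :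
    HasOneSidedApproxDegreeLE ε d f := by
  obtain ⟨p, hp, hpf⟩ := h
  refine ⟨p, hp, fun x _ => by rw [abs_sub_comm]; exact hpf x, fun x hx => ?_⟩
  have := (abs_le.1 (hpf x)).1
  rw [hx] at this
  linarith

/-- Monotonicity in `d` and `ε`. [cite: BunThaler2015, §3.1.2] -/
theorem HasOneSidedApproxDegreeLE.mono {ε ε' : ℝ} {d d' : ℕ} {f : (Fin n → Bool) → ℝ}
    (h : HasOneSidedApproxDegreeLE ε d f) (hd : d ≤ d') (hε : ε ≤ ε') :
    HasOneSidedApproxDegreeLE ε' d' f := by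
  obtain ⟨p, ⟨P, hP, hPp⟩, h1, h2⟩ := h
  exact ⟨p, ⟨P, hP.trans hd, hPp⟩, fun x hx => (h1 x hx).trans hε,
    fun x hx => (h2 x hx).trans (by linarith)⟩

/-- `odeg_ε(f) ≤ n` for `ε ≥ 0` (`p = f`). [cite: BunThaler2015, §3.1.2] -/
theorem hasOneSidedApproxDegreeLE_self {ε : ℝ} (hε : 0 ≤ ε) (f : (Fin n → Bool) → ℝ) :
    HasOneSidedApproxDegreeLE ε n f :=
  ⟨f, hasDegreeLE_card f, fun x _ => by simpa using hε, fun x hx => by rw [hx]; linarith⟩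

/-- `odeg_ε(f) ≤ d ↔ HasOneSidedApproxDegreeLE ε d f` (the infimum is a minimum). [cite: BunThaler2015, §3.1.2] -/
theorem oneSidedApproxDegree_le_iff {ε : ℝ} (hε : 0 ≤ ε) {d : ℕ} {f : (Fin n → Bool) → ℝ} :
    oneSidedApproxDegree ε f ≤ d ↔ HasOneSidedApproxDegreeLE ε d f := by
  constructor
  · intro h
    have hne : {d | HasOneSidedApproxDegreeLE ε d f}.Nonempty := ⟨n, hasOneSidedApproxDegreeLE_self hε f⟩
    exact (Nat.sInf_mem hne).mono h le_rfl
  · intro h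
    exact Nat.sInf_le h

/-- `odeg_ε(f) > d ↔ ¬ (odeg_ε(f) ≤ d)`. [cite: BunThaler2015, §3.1.2] -/
theorem lt_oneSidedApproxDegree_iff {ε : ℝ} (hε : 0 ≤ ε) {d : ℕ} {f : (Fin n → Bool) → ℝ} :
    d < oneSidedApproxDegree ε f ↔ ¬ HasOneSidedApproxDegreeLE ε d f := by
  rw [← oneSidedApproxDegree_le_iff hε, not_le]

/-! ### Weak duality -/

/-- **Weak duality**: a dual polynomial with one-sided error rules out every `ε`-one-sided
approximation of degree `≤ d`: `Σ fφ = Σ (f − p)φ ≤ ε Σ|φ| = ε`, the middle step pointwise — where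
`f ≠ −1` by `|f − p| ≤ ε`, where `f = −1` by `f − p ≥ −ε` and `φ ≤ 0`. [cite: BunThaler2015, Thm 6 "if" (§3.1.2)] -/
theorem IsOneSidedDualPolynomial.not_hasOneSidedApproxDegreeLE {ε : ℝ} {d : ℕ}
    {f φ : (Fin n → Bool) → ℝ} (hφ : IsOneSidedDualPolynomial ε d f φ) :
    ¬ HasOneSidedApproxDegreeLE ε d f := by
  rintro ⟨p, hp, h1, h2⟩
  obtain ⟨⟨hval, hnorm, hpure⟩, hsign⟩ := hφ
  have h0 : ∑ x, p x * φ x = 0 := hpure.sum_mul_eq_zero hp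
  have key : ∑ x, f x * φ x ≤ ε := by
    calc ∑ x, f x * φ x = ∑ x, (f x - p x) * φ x + ∑ x, p x * φ x := by
          rw [← sum_add_distrib]; exact sum_congr rfl fun x _ => by ring
      _ = ∑ x, (f x - p x) * φ x := by rw [h0, add_zero]
      _ ≤ ∑ x, ε * |φ x| := sum_le_sum fun x _ => by
          by_cases hx : f x = -1
          · have hφx := hsign x hx
            have hpx := h2 x hx
            rw [abs_of_nonpos hφx, hx]
            nlinarith [mul_nonneg (sub_nonneg.2 hpx) (neg_nonneg.2 hφx)]
          · have hpx := abs_le.1 (h1 x hx)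
            calc (f x - p x) * φ x ≤ |(f x - p x) * φ x| := le_abs_self _
              _ = |f x - p x| * |φ x| := abs_mul _ _
              _ ≤ ε * |φ x| := mul_le_mul_of_nonneg_right
                  (by rw [abs_sub_comm]; exact h1 x hx) (abs_nonneg _)
      _ = ε := by rw [← mul_sum, hnorm, mul_one]
  linarith

/-! ### The linear program of §3.1.2 and strong duality -/

/-- The polynomial encoded by the coefficient block of an LP point `z = ((c_S)_S, t)`:
`p_z = Σ_{|S|≤d} c_S χ_S` (coefficients of `|S| > d` are ignored). [cite: BunThaler2015, §3.1.2, primal LP] -/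
def poly (d : ℕ) (z : Option (Finset (Fin n)) → ℝ) : (Fin n → Bool) → ℝ :=
  fun x => ∑ S ∈ univ.filter (fun S : Finset (Fin n) => S.card ≤ d), z (some S) * walsh S x

/-- `deg p_z ≤ d`. [cite: BunThaler2015, §3.1.2] -/
theorem hasDegreeLE_poly (d : ℕ) (z : Option (Finset (Fin n)) → ℝ) : HasDegreeLE d (poly d z) := by
  rw [hasDegreeLE_iff_cubeFourierCoeff_eq_zero]
  intro S hS
  unfold poly
  rw [cubeFourierCoeff_sum_walsh, if_neg]
  simp [not_le.2 hS]

/-- The primal LP of §3.1.2 as `max{−t : Az ≤ b}` in the unknowns `z = ((c_S)_S, t)` (index `none`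
= `t`): row `(x, +)`: `p_z(x) − t ≤ f(x)`; row `(x, −)` for `f(x) ≠ −1`: `−p_z(x) − t ≤ −f(x)` (zero row
when `f(x) = −1`); last row: `−t ≤ 0`. [cite: BunThaler2015, §3.1.2, primal LP] -/
def lpMatrix (d : ℕ) (f : (Fin n → Bool) → ℝ) :
    Matrix (((Fin n → Bool) × Bool) ⊕ Unit) (Option (Finset (Fin n))) ℝ
  | Sum.inl (x, false), some S => if S.card ≤ d then walsh S x else 0
  | Sum.inl (_, false), none => -1
  | Sum.inl (x, true), some S => if f x = -1 then 0 else -(if S.card ≤ d then walsh S x else 0)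
  | Sum.inl (x, true), none => if f x = -1 then 0 else -1
  | Sum.inr _, some _ => 0
  | Sum.inr _, none => -1

/-- Its right-hand side. [cite: BunThaler2015, §3.1.2, primal LP] -/
def lpRhs (f : (Fin n → Bool) → ℝ) : ((Fin n → Bool) × Bool) ⊕ Unit → ℝ
  | Sum.inl (x, false) => f x
  | Sum.inl (x, true) => if f x = -1 then 0 else -f x
  | Sum.inr _ => 0

/-- Its objective `−t` (the printed `min ε`). [cite: BunThaler2015, §3.1.2, primal LP] -/
def lpObj (n : ℕ) : Option (Finset (Fin n)) → ℝ
  | none => -1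
  | some _ => 0

/-- Row `(x, +)` of `Az`. [cite: BunThaler2015, §3.1.2] -/
theorem lpMatrix_mulVec_inl_false (d : ℕ) (f : (Fin n → Bool) → ℝ) (z : Option (Finset (Fin n)) → ℝ)
    (x : Fin n → Bool) : (lpMatrix d f *ᵥ z) (Sum.inl (x, false)) = poly d z x - z none := by
  simp only [mulVec, dotProduct, poly]
  rw [Fintype.sum_option, sum_filter]
  simp only [lpMatrix]
  rw [neg_one_mul, add_comm, ← sub_eq_add_neg]
  congr 1
  exact sum_congr rfl fun S _ => by split_ifs <;> ring

/-- Row `(x, −)` of `Az`. [cite: BunThaler2015, §3.1.2] -/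
theorem lpMatrix_mulVec_inl_true (d : ℕ) (f : (Fin n → Bool) → ℝ) (z : Option (Finset (Fin n)) → ℝ)
    (x : Fin n → Bool) :
    (lpMatrix d f *ᵥ z) (Sum.inl (x, true)) = if f x = -1 then 0 else -(poly d z x) - z none := by
  simp only [mulVec, dotProduct, poly]
  rw [Fintype.sum_option, sum_filter]
  simp only [lpMatrix]
  by_cases hx : f x = -1
  · simp [hx]
  · simp only [hx, if_false]
    rw [neg_one_mul, add_comm, ← sub_eq_add_neg, ← sum_neg_distrib]
    congr 1
    exact sum_congr rfl fun S _ => by split_ifs <;> ring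

/-- The last row of `Az`. [cite: BunThaler2015, §3.1.2] -/
theorem lpMatrix_mulVec_inr (d : ℕ) (f : (Fin n → Bool) → ℝ) (z : Option (Finset (Fin n)) → ℝ)
    (u : Unit) : (lpMatrix d f *ᵥ z) (Sum.inr u) = -z none := by
  simp only [mulVec, dotProduct]
  rw [Fintype.sum_option]
  simp [lpMatrix]

/-- Column `c_S` of `yA`: `[|S| ≤ d] Σ_x ψ(x)χ_S(x)` with `ψ = y⁺ − y⁻·𝟙[f ≠ −1]`.
[cite: BunThaler2015, §3.1.2, dual LP] -/
theorem vecMul_lpMatrix_some (d : ℕ) (f : (Fin n → Bool) → ℝ)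
    (y : ((Fin n → Bool) × Bool) ⊕ Unit → ℝ) (S : Finset (Fin n)) :
    (y ᵥ* lpMatrix d f) (some S) = if S.card ≤ d then
      ∑ x, (y (Sum.inl (x, false)) - if f x = -1 then 0 else y (Sum.inl (x, true))) * walsh S x
      else 0 := by
  have key : ∀ x : Fin n → Bool,
      y (Sum.inl (x, true)) * lpMatrix d f (Sum.inl (x, true)) (some S) +
          y (Sum.inl (x, false)) * lpMatrix d f (Sum.inl (x, false)) (some S) =
        if S.card ≤ d then
          (y (Sum.inl (x, false)) - if f x = -1 then 0 else y (Sum.inl (x, true))) * walsh S x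
        else 0 := fun x => by
    simp only [lpMatrix]
    split_ifs <;> ring
  have key' : ∀ u : Unit, lpMatrix d f (Sum.inr u) (some S) = 0 := fun u => by simp [lpMatrix]
  simp only [vecMul, dotProduct]
  rw [Fintype.sum_sum_type, Fintype.sum_prod_type]
  simp only [Fintype.sum_bool, key, key', univ_unique, sum_singleton, mul_zero, add_zero]
  split_ifs
  · rfl
  · simp

/-- Column `t` of `yA`: `−(Σ_x (y⁺_x + y⁻_x 𝟙[f(x) ≠ −1]) + s)`. [cite: BunThaler2015, §3.1.2, dual LP] -/
theorem vecMul_lpMatrix_none (d : ℕ) (f : (Fin n → Bool) → ℝ)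
    (y : ((Fin n → Bool) × Bool) ⊕ Unit → ℝ) :
    (y ᵥ* lpMatrix d f) none =
      -(∑ x, (y (Sum.inl (x, false)) + if f x = -1 then 0 else y (Sum.inl (x, true)))) -
        y (Sum.inr ()) := by
  have key : ∀ x : Fin n → Bool,
      y (Sum.inl (x, true)) * lpMatrix d f (Sum.inl (x, true)) none +
          y (Sum.inl (x, false)) * lpMatrix d f (Sum.inl (x, false)) none =
        -(y (Sum.inl (x, false)) + if f x = -1 then 0 else y (Sum.inl (x, true))) := fun x => by
    simp only [lpMatrix]
    split_ifs <;> ring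
  have key' : ∀ u : Unit, lpMatrix d f (Sum.inr u) none = -1 := fun u => by simp [lpMatrix]
  simp only [vecMul, dotProduct]
  rw [Fintype.sum_sum_type, Fintype.sum_prod_type]
  simp only [Fintype.sum_bool, key, key', univ_unique, sum_singleton, sum_neg_distrib,
    PUnit.default_eq_unit]
  ring

/-- The dual objective `yb = Σ_x ψ(x) f(x)`. [cite: BunThaler2015, §3.1.2, dual LP] -/
theorem dotProduct_lpRhs (f : (Fin n → Bool) → ℝ) (y : ((Fin n → Bool) × Bool) ⊕ Unit → ℝ) :
    y ⬝ᵥ lpRhs f =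
      ∑ x, (y (Sum.inl (x, false)) - if f x = -1 then 0 else y (Sum.inl (x, true))) * f x := by
  have key : ∀ x : Fin n → Bool,
      y (Sum.inl (x, true)) * lpRhs f (Sum.inl (x, true)) +
          y (Sum.inl (x, false)) * lpRhs f (Sum.inl (x, false)) =
        (y (Sum.inl (x, false)) - if f x = -1 then 0 else y (Sum.inl (x, true))) * f x := fun x => by
    simp only [lpRhs]
    split_ifs <;> ring
  have key' : ∀ u : Unit, lpRhs f (Sum.inr u) = 0 := fun u => by simp [lpRhs]
  simp only [dotProduct]
  rw [Fintype.sum_sum_type, Fintype.sum_prod_type]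
  simp only [Fintype.sum_bool, key, key', univ_unique, sum_singleton, mul_zero, add_zero]

/-- The primal objective `−t`. [cite: BunThaler2015, §3.1.2, primal LP] -/
theorem lpObj_dotProduct (z : Option (Finset (Fin n)) → ℝ) : lpObj n ⬝ᵥ z = -z none := by
  simp only [dotProduct]
  rw [Fintype.sum_option]
  simp [lpObj]

/-- **Strong duality** (Theorem 6, "only if"): if `f` has no `ε`-one-sided approximation of degree
`≤ d` (`ε ≥ 0`) then a dual polynomial with one-sided error exists.  Proof as printed ("we again
appeal to strong LP-duality"): the primal `max{−t}` is feasible (`c = 0`, `t = Σ|f|`) and so is the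
dual (`s = 1`), so by `LPDuality.duality` there is an optimal pair `(z*, y*)` with `−t* = y*b`; since
`p_{z*}` is a `t*`-one-sided approximation of degree `≤ d`, `t* > ε`; the dual vector read as
`φ = y⁻𝟙[f ≠ −1] − y⁺` has pure high degree `d` (`y*A = c` on the `c_S` columns), `Σ|φ| ≤ 1` (the `t`
column), `Σ fφ = t* > ε`, `φ ≤ 0` on `f⁻¹(−1)`; normalise by `Σ|φ| ∈ (0, 1]`.
[cite: BunThaler2015, Thm 6 (§3.1.2)] -/
theorem exists_oneSidedDualPolynomial {ε : ℝ} (hε : 0 ≤ ε) {d : ℕ} {f : (Fin n → Bool) → ℝ}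
    (hf : ¬ HasOneSidedApproxDegreeLE ε d f) : ∃ φ, IsOneSidedDualPolynomial ε d f φ := by
  -- primal feasibility: `c = 0`, `t = Σ |f|`
  have hP : ∃ z : Option (Finset (Fin n)) → ℝ, lpMatrix d f *ᵥ z ≤ lpRhs f := by
    set M : ℝ := ∑ x, |f x| with hM
    set z0 : Option (Finset (Fin n)) → ℝ := fun k => Option.elim k M (fun _ => 0) with hz0
    refine ⟨z0, fun r => ?_⟩
    have hpoly : ∀ x : Fin n → Bool, poly d z0 x = 0 := fun x => by
      simp [poly, hz0]
    have hz0n : z0 none = M := rfl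
    have hfx : ∀ x, |f x| ≤ M := fun x => single_le_sum (fun y _ => abs_nonneg (f y)) (mem_univ x)
    rcases r with ⟨x, b⟩ | u
    · cases b
      · rw [lpMatrix_mulVec_inl_false, hpoly, hz0n]
        simp only [lpRhs, zero_sub]
        linarith [hfx x, neg_abs_le (f x)]
      · rw [lpMatrix_mulVec_inl_true, hpoly, hz0n]
        simp only [lpRhs, neg_zero, zero_sub]
        split_ifs
        · exact le_rfl
        · linarith [hfx x, le_abs_self (f x)]
    · rw [lpMatrix_mulVec_inr, hz0n]
      simp only [lpRhs, neg_nonpos]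
      exact sum_nonneg fun x _ => abs_nonneg _
  -- dual feasibility: `s = 1`, all other multipliers `0`
  have hD : ∃ y : ((Fin n → Bool) × Bool) ⊕ Unit → ℝ, 0 ≤ y ∧ y ᵥ* lpMatrix d f = lpObj n := by
    refine ⟨Sum.elim (fun _ => 0) (fun _ => 1), fun r => ?_, funext fun k => ?_⟩
    · rcases r with r | u <;> simp
    · cases k with
      | none => rw [vecMul_lpMatrix_none]; simp [lpObj]
      | some S => rw [vecMul_lpMatrix_some]; simp [lpObj]
  obtain ⟨z, y, hzA, hy0, hyA, hval⟩ :=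
    Literature.Analysis.Convex.LPDuality.duality (lpMatrix d f) (lpRhs f) (lpObj n) hP hD
  -- the optimal value `t*` exceeds `ε`
  have ht : ε < z none := by
    by_contra hle
    push Not at hle
    refine hf ⟨poly d z, hasDegreeLE_poly d z, fun x hx => ?_, fun x hx => ?_⟩
    · have h1 := hzA (Sum.inl (x, false))
      have h2 := hzA (Sum.inl (x, true))
      rw [lpMatrix_mulVec_inl_false] at h1
      rw [lpMatrix_mulVec_inl_true, if_neg hx] at h2
      simp only [lpRhs, hx, if_false] at h1 h2
      rw [abs_le]
      constructor <;> linarith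
    · have h1 := hzA (Sum.inl (x, false))
      rw [lpMatrix_mulVec_inl_false] at h1
      simp only [lpRhs] at h1
      rw [hx] at h1
      linarith
  -- the dual vector as a function on the cube
  set ψ : (Fin n → Bool) → ℝ := fun x =>
    y (Sum.inl (x, false)) - if f x = -1 then 0 else y (Sum.inl (x, true)) with hψ
  have hpure : ∀ S : Finset (Fin n), S.card ≤ d → ∑ x, ψ x * walsh S x = 0 := fun S hS => by
    have h := congrFun hyA (some S)
    rw [vecMul_lpMatrix_some, if_pos hS] at h
    simpa [lpObj] using h
  have hmass : ∑ x, |ψ x| ≤ 1 := by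
    have h := congrFun hyA none
    rw [vecMul_lpMatrix_none] at h
    simp only [lpObj] at h
    have hs : 0 ≤ y (Sum.inr ()) := hy0 _
    calc ∑ x, |ψ x| ≤ ∑ x, (y (Sum.inl (x, false)) + if f x = -1 then 0 else y (Sum.inl (x, true))) :=
          sum_le_sum fun x _ => by
            have h1 : 0 ≤ y (Sum.inl (x, false)) := hy0 _
            have h2 : 0 ≤ y (Sum.inl (x, true)) := hy0 _
            rw [hψ]
            dsimp only
            split_ifs
            · rw [sub_zero, add_zero, abs_of_nonneg h1]
            · rw [abs_sub_le_iff]; constructor <;> linarith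
      _ ≤ 1 := by linarith
  have hvalue : ∑ x, f x * ψ x = -z none := by
    rw [lpObj_dotProduct, dotProduct_lpRhs] at hval
    rw [hval]
    exact sum_congr rfl fun x _ => by ring
  have hsign : ∀ x, f x = -1 → 0 ≤ ψ x := fun x hx => by
    rw [hψ]
    dsimp only
    rw [if_pos hx, sub_zero]
    exact hy0 _
  -- `φ = −ψ / Σ|ψ|`
  have hN : 0 < ∑ x, |ψ x| := by
    rcases (sum_nonneg fun x (_ : x ∈ (univ : Finset (Fin n → Bool))) => abs_nonneg (ψ x)).lt_or_eq with h | h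
    · exact h
    · exfalso
      have hz : ∀ x, ψ x = 0 := fun x =>
        abs_eq_zero.1 (le_antisymm ((single_le_sum (fun y _ => abs_nonneg (ψ y)) (mem_univ x)).trans
          h.symm.le) (abs_nonneg _))
      have : ∑ x, f x * ψ x = 0 := sum_eq_zero fun x _ => by rw [hz x, mul_zero]
      linarith
  set N := ∑ x, |ψ x| with hNdef
  refine ⟨fun x => -(N⁻¹ * ψ x), ⟨?_, ?_, fun S hS => ?_⟩, fun x hx => ?_⟩
  · have e1 : ∑ x, f x * -(N⁻¹ * ψ x) = N⁻¹ * (-(∑ x, f x * ψ x)) := by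
      rw [← sum_neg_distrib, mul_sum]; exact sum_congr rfl fun x _ => by ring
    rw [e1, hvalue, neg_neg, lt_inv_mul_iff₀ hN]
    have hN1 : N ≤ 1 := hmass
    nlinarith
  · have e2 : ∑ x, |-(N⁻¹ * ψ x)| = N⁻¹ * ∑ x, |ψ x| := by
      rw [mul_sum]
      exact sum_congr rfl fun x _ => by rw [abs_neg, abs_mul, abs_of_pos (inv_pos.2 hN)]
    rw [e2, inv_mul_cancel₀ hN.ne']
  · have e3 : ∑ x, -(N⁻¹ * ψ x) * walsh S x = -(N⁻¹ * ∑ x, ψ x * walsh S x) := by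
      rw [mul_sum, ← sum_neg_distrib]; exact sum_congr rfl fun x _ => by ring
    rw [e3, hpure S hS, mul_zero, neg_zero]
  · have := hsign x hx
    have hNi : 0 < N⁻¹ := inv_pos.2 hN
    nlinarith

/-- **Theorem 6 in `HasOneSidedApproxDegreeLE` form:** for `ε ≥ 0`, `f` has NO `ε`-one-sided
approximation of degree `≤ d` iff a dual polynomial for `f` with one-sided error exists.
[cite: BunThaler2015, Thm 6 (§3.1.2)] -/
theorem not_hasOneSidedApproxDegreeLE_iff {ε : ℝ} (hε : 0 ≤ ε) {d : ℕ} {f : (Fin n → Bool) → ℝ} :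
    ¬ HasOneSidedApproxDegreeLE ε d f ↔ ∃ φ, IsOneSidedDualPolynomial ε d f φ :=
  ⟨exists_oneSidedDualPolynomial hε, fun ⟨_, hφ⟩ => hφ.not_hasOneSidedApproxDegreeLE⟩

/-- **Bun–Thaler 2015, Theorem 6 (dual characterization of one-sided approximate degree)**, for
every real `f` on the cube and every `ε ≥ 0`: "`odeg_ε(f) > d` if and only if there is a polynomial
`φ : {−1,1}ⁿ → ℝ` such that `Σ_x f(x)φ(x) > ε`, `Σ_x |φ(x)| = 1`, `Σ_x φ(x)χ_S(x) = 0` for each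
`|S| ≤ d`, and `φ(x) ≤ 0` for each `x ∈ f⁻¹(−1)`" (print: Boolean `f`).
[cite: BunThaler2015, Thm 6 (§3.1.2)] -/
theorem BunThaler2015_thm6 {ε : ℝ} (hε : 0 ≤ ε) (d : ℕ) (f : (Fin n → Bool) → ℝ) :
    d < oneSidedApproxDegree ε f ↔ ∃ φ, IsOneSidedDualPolynomial ε d f φ := by
  rw [lt_oneSidedApproxDegree_iff hε, not_hasOneSidedApproxDegreeLE_iff hε]

end Literature.Computability.Complexity.OneSidedApproximateDegree
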